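import Summits.NavierStokesRegularity.NavierStokesRegularity.Theorems.SqueezeCycleSingularZoomExtraction
import Summits.NavierStokesRegularity.NavierStokesRegularity.Theorems.SqueezeCycleSingularZoomEnergy
import Summits.NavierStokesRegularity.NavierStokesRegularity.Theorems.SqueezeCycleExtremalElementExistsRescale
import Summits.NavierStokesRegularity.NavierStokesRegularity.Theorems.ClockStretchingLawClockLawStubLimitSingular
import HarnessLib

/-!
# Subsequential limits of zooms in the Type-I model class
# (route `ClockStretchingLaw`, crux `ClockLaw`, stmt-NavierStokesRegularity-10571, line `birth`,
# stub `stub_zoomExtraction`)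

Let `u` be a Type-I KNSS-mild ancient field (`IsTypeIAncientMild C u`) carrying the
scale-invariant energy ledger of the route's class `𝒦_C` — `r⁻¹ ∫_{B(x₀,r)} |u(t)|² ≤ C` for
`t ∈ (t₀ - r², t₀)` and `r⁻¹ ∫_{(t₀-r²,t₀)} ∫_{B(x₀,r)} |∇u|² ≤ C` on every backward parabolic
cylinder with vertex time `t₀ ≤ 0` — and let `c n > 0` be any scales. Then the Navier–Stokes zooms
about the origin, `w n (s, y) = c n • u ((c n)² s, (c n) y)` (`c n • stPull ((c n)²) (c n) 0 0 u`),
converge pointwise on the open slab `(-∞, 0) × ℝ³`, along a subsequence, to a field `W` of the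
same class with the SAME constant and the same ledger (`stub_zoomExtraction`).

Pure bookkeeping over proved tree theorems: each zoom is again Type-I KNSS-mild with constant `C`
(`isTypeIAncientMild_zoom`) and carries the same ledger (the sibling stub file's
`limitSingular_energyLedger_zoom`, from `scaledEnergy_zoom` / `scaledGradEnergy_zoom`: the zoomed
energies are the original ones on the cylinder `Q((c² t₀, c y₀), c r)`, whose vertex time is again
`≤ 0`, and the ledger controls the energy at every fixed negative time,
`scaledEnergy_le_of_ledger`); the `C¹_loc` compactness `exists_tendsto_of_typeI_seq_Ioo`
(KNSS 2009, Prop. 4.1 + Lemma 6.1) on the windows `(-k, 0)` extracts the limit, and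
`energyBounds_of_tendsto_Ioo` passes the ledger to it.
-/

noncomputable section

open MeasureTheory Filter Topology Set Metric Function
open scoped Topology NNReal ENNReal

-- Summit = Problem namespace duplication is the tree's layout (CONVENTIONS §1); as in every Theorems file.
set_option linter.dupNamespace false

namespace Summit.NavierStokesRegularity.NavierStokesRegularity.Theorems.ClockLaw.Birth

open Literature.Analysis Literature.Analysis.FluidPDE
open Summit.NavierStokesRegularity.NavierStokesRegularity.Theorems

/-- Local notation: `ℝ³`. -/
local notation "E3" => EuclideanSpace ℝ (Fin 3)

/-- **The energy at every negative time is controlled by the ledger**: if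
`r⁻¹ ∫_{B(x₀,r)} |u(t)|² ≤ C` for all `t ∈ (t₀ - r², t₀)` and all vertex times `t₀ ≤ 0`, then
`r⁻¹ ∫_{B(x₀,r)} |u(t)|² ≤ C` for every `t < 0` (use the vertex `t₀ = min 0 (t + r²/2)`). -/
theorem scaledEnergy_le_of_ledger {C : ℝ} {u : ℝ → E3 → E3}
    (hE : ∀ (x₀ : EuclideanSpace ℝ (Fin 3)) (t₀ r : ℝ), t₀ ≤ 0 → 0 < r →
      (∀ t, t₀ - r ^ 2 < t → t < t₀ → r⁻¹ * ∫ x in Metric.ball x₀ r, ‖u t x‖ ^ 2 ≤ C) ∧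
        r⁻¹ * ∫ t in Set.Ioo (t₀ - r ^ 2) t₀, ∫ x in Metric.ball x₀ r, ‖fderiv ℝ (u t) x‖ ^ 2 ≤ C)
    (x₀ : EuclideanSpace ℝ (Fin 3)) {t : ℝ} (ht : t < 0) {r : ℝ} (hr : 0 < r) :
    r⁻¹ * ∫ x in Metric.ball x₀ r, ‖u t x‖ ^ 2 ≤ C := by
  have hr2 : 0 < r ^ 2 := by positivity
  refine (hE x₀ (min 0 (t + r ^ 2 / 2)) r (min_le_left _ _) hr).1 t ?_ (lt_min ht (by linarith))
  linarith [min_le_right (0 : ℝ) (t + r ^ 2 / 2)]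

/-- **Stub `stub_zoomExtraction` — subsequential limits of zooms stay in the class `𝒦_C`.**
For a Type-I KNSS-mild field `u` (`IsTypeIAncientMild C u`) with the scale-invariant energy
ledger `A, E ≤ C` on all backward cylinders with vertex time `≤ 0`, and positive scales `c n`,
some subsequence of the zooms `c (φ j) • stPull (c (φ j) ^ 2) (c (φ j)) 0 0 u` converges pointwise
on the open slab `(-∞, 0) × ℝ³` to a field `W` with `IsTypeIAncientMild C W` and the same ledger.
Bookkeeping over `isTypeIAncientMild_zoom`, `limitSingular_energyLedger_zoom`,
`exists_tendsto_of_typeI_seq_Ioo` (windows `(-k, 0)`) and `energyBounds_of_tendsto_Ioo`. -/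
theorem stub_zoomExtraction :
    ∀ (C : ℝ) (u : ℝ → E3 → E3), IsTypeIAncientMild C u →
      (∀ (x₀ : EuclideanSpace ℝ (Fin 3)) (t₀ r : ℝ), t₀ ≤ 0 → 0 < r →
        (∀ t, t₀ - r ^ 2 < t → t < t₀ → r⁻¹ * ∫ x in Metric.ball x₀ r, ‖u t x‖ ^ 2 ≤ C) ∧
          r⁻¹ * ∫ t in Set.Ioo (t₀ - r ^ 2) t₀, ∫ x in Metric.ball x₀ r, ‖fderiv ℝ (u t) x‖ ^ 2 ≤ C) →
      ∀ c : ℕ → ℝ, (∀ n, 0 < c n) →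
        ∃ φ : ℕ → ℕ, StrictMono φ ∧ ∃ W : ℝ → E3 → E3,
          IsTypeIAncientMild C W ∧
          (∀ (x₀ : EuclideanSpace ℝ (Fin 3)) (t₀ r : ℝ), t₀ ≤ 0 → 0 < r →
            (∀ t, t₀ - r ^ 2 < t → t < t₀ → r⁻¹ * ∫ x in Metric.ball x₀ r, ‖W t x‖ ^ 2 ≤ C) ∧
              r⁻¹ * ∫ t in Set.Ioo (t₀ - r ^ 2) t₀, ∫ x in Metric.ball x₀ r, ‖fderiv ℝ (W t) x‖ ^ 2 ≤ C) ∧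
          ∀ t < 0, ∀ x, Tendsto
            (fun j => (c (φ j) • stPull (c (φ j) ^ 2) (c (φ j)) 0 0 u) t x) atTop (𝓝 (W t x)) := by
  intro C u hu hE c hc
  -- the zooms: Type-I KNSS-mild with constant `C`, same ledger
  set w : ℕ → ℝ → E3 → E3 := fun k => c k • stPull (c k ^ 2) (c k) 0 0 u with hw
  have hwk : ∀ k, IsTypeIAncientMild C (w k) := fun k => isTypeIAncientMild_zoom hu (hc k) 0
  have hEk := fun k => limitSingular_energyLedger_zoom hu hE (hc k)
  -- the growing final windows `(-k, 0)`
  set A : ℕ → ℝ := fun k => -(k : ℝ) with hA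
  have hAt : Tendsto A atTop atBot := tendsto_neg_atTop_atBot.comp tendsto_natCast_atTop_atTop
  have hcont : ∀ k, ContinuousOn (uncurry (w k)) (Ioo (A k) 0 ×ˢ univ) := fun k =>
    (hwk k).continuousOn_uncurry.mono (prod_mono (fun t ht => ht.2) subset_rfl)
  have hdivw : ∀ k, ∀ t ∈ Ioo (A k) 0, IsWeaklyDivFree (w k t) := fun k t ht =>
    (hwk k).isWeaklyDivFree ht.2
  have hmild : ∀ k, ∀ s t : ℝ, A k < s → s < t → t < 0 → ∀ x,
      w k t x = UnboundedOperators.heatExtension (w k s) (t - s) x -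
        oseenDuhamel 1 s (w k) (w k) t x :=
    fun k s t _ hst ht x => (hwk k).mild_eq_heatExtension hst ht x
  have hI : ∀ k, ∀ t ∈ Ioo (A k) 0, ∀ x, ‖w k t x‖ ≤ C / Real.sqrt (-t) := fun k t ht x =>
    (hwk k).norm_le ht.2 x
  -- extraction
  obtain ⟨φ, hφ, W, hW, hpt, hptG, -, -⟩ :=
    exists_tendsto_of_typeI_seq_Ioo C hAt hcont hdivw hmild hI
  refine ⟨φ, hφ, W, hW, ?_, fun t ht x => hpt t ht x⟩
  -- the ledger passes to the limit along the subsequence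
  have hAφ : Tendsto (fun j => A (φ j)) atTop atBot := hAt.comp hφ.tendsto_atTop
  exact energyBounds_of_tendsto_Ioo C (B := C) hu.nonneg hAφ (w := fun j => w (φ j))
    (fun j => hcont (φ j)) (fun j => hdivw (φ j)) (fun j => hmild (φ j)) (fun j => hI (φ j))
    (fun x₀ t ht r hr => Eventually.of_forall fun j =>
      scaledEnergy_le_of_ledger (hEk (φ j)) x₀ ht hr)
    (fun x₀ t₀ r ht₀ hr => Eventually.of_forall fun j => (hEk (φ j) x₀ t₀ r ht₀.le hr).2)
    hW hpt hptG

end Summit.NavierStokesRegularity.NavierStokesRegularity.Theorems.ClockLaw.Birth
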